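import Summits.AnomalousDissipation.AnomalousDissipation.Theorems.SolenoidalFractalHomogenisationLagrangianCarrierConstructionFlowsL
import Literature.Analysis.FunctionSpaces.TorusCalculusProofs
import HarnessLib

/-!
# K3L `LagrangianCarrierConstruction` (stmt-AnomalousDissipation-24913), line `birth`: pushing a weakly divergence-free field forward by a
# volume-preserving lattice-equivariant diffeomorphism keeps it weakly divergence free (helper; `--supports stmt-AnomalousDissipation-24913`)

Summits-side helper file (everything proved; no definitions, no named facts). Clause (L2) of `LevelRegular` for ONE level of the
Lagrangian tower, in the tower's own terms: if `Φ : ℝᵈ → ℝᵈ` is a smooth lattice-equivariant map with a right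
inverse `Ψ` whose torus map `x ↦ proj (Ψ (repr x))` preserves the volume of the torus, and `u` is a continuous weakly
divergence-free field on the torus, then the pushed-forward field `b x = DΦ(Ψ x̃) · u(Ψ x̃)` (`x̃ = repr x`) is weakly divergence
free. Proof = change of variables, no divergence computed: for a smooth test function `θ`,
`⟪b x, ∇θ x⟫ = D(θ̃ ∘ Φ)(Ψ x̃) · u(Ψ x̃)` (chain rule, `θ̃ = lift θ`), so `∫ ⟪b, ∇θ⟫ = ∫ (D(θ̃∘Φ) · ũ) ∘ Ψ = ∫ D(θ̃∘Φ) · ũ = ∫ ⟪u, ∇(θ ∘ X)⟫ = 0`,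
the middle step by volume preservation and the last because `θ ∘ X` is again a smooth test function. Infrastructure for route-1's
rung leaf F-D1.A0 (a frontier FORMAL rung); NOT a proof of anomalous dissipation.
-/

set_option linter.dupNamespace false

noncomputable section

namespace Summit.AnomalousDissipation.AnomalousDissipation.Theorems.SolenoidalFractalHomogenisation.LagrangianCarrierConstruction

open Set Function Filter Topology MeasureTheory
open scoped ContDiff InnerProductSpace
open Literature.Analysis Literature.Analysis.FunctionSpaces Literature.Analysis.FunctionSpaces.Torus

variable {d : Type*} [Fintype d] [DecidableEq d]

/-- **(L2) for one level: the pushforward of a weakly divergence-free field by a volume-preserving equivariant diffeomorphism is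
weakly divergence free.** [cite: ArmstrongVicol2025, §2.2 (PDF p. 18: ∇·b_m = 0 since the X_{m−1} preserve the area)] -/
theorem isWeaklyDivFree_pushforward (Φ Ψ : EuclideanSpace ℝ d → EuclideanSpace ℝ d) (hΦΨ : ∀ z, Φ (Ψ z) = z)
    (hΦeq : ∀ z (k : d → ℤ), Φ (z + latticeVec k) = Φ z + latticeVec k) (hΦ : ContDiff ℝ ∞ Φ)
    (u : UnitAddTorus d → EuclideanSpace ℝ d) (hu : IsWeaklyDivFree u) (huc : Continuous u)
    (hMP : MeasurePreserving (fun x : UnitAddTorus d => proj (Ψ (repr x))) volume volume)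
    (b : UnitAddTorus d → EuclideanSpace ℝ d) (hb : ∀ x, b x = fderiv ℝ Φ (Ψ (repr x)) (u (proj (Ψ (repr x))))) :
    IsWeaklyDivFree b := by
  intro θ hθ
  -- the pulled-back test function and its lift
  have hg : Torus.lift (fun y : UnitAddTorus d => θ (proj (Φ (repr y)))) = Torus.lift θ ∘ Φ := by
    funext z
    rw [Torus.lift_apply, comp_apply, Torus.lift_apply]
    obtain ⟨k, hk⟩ := exists_repr_proj_eq_add_latticeVec_holds z
    rw [hk, hΦeq, proj_add_latticeVec]
  have hgs : ContDiff ℝ ∞ (Torus.lift θ ∘ Φ) := hθ.comp hΦ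
  have hθX : IsSmooth fun y : UnitAddTorus d => θ (proj (Φ (repr y))) := by
    unfold IsSmooth; rw [hg]; exact hgs
  -- the integrand after the change of variables: `H z = D(θ̃ ∘ Φ)(z) · u (proj z)`, lattice periodic and continuous
  have hHper : ∀ z (k : d → ℤ), fderiv ℝ (Torus.lift θ ∘ Φ) (z + latticeVec k) (u (proj (z + latticeVec k))) =
      fderiv ℝ (Torus.lift θ ∘ Φ) z (u (proj z)) := by
    intro z k
    rw [proj_add_latticeVec, ← fderiv_comp_add_right]
    congr 2
    funext y
    rw [comp_apply, comp_apply, hΦeq, Torus.lift_apply, Torus.lift_apply, proj_add_latticeVec]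
  have hHc : Continuous fun z => fderiv ℝ (Torus.lift θ ∘ Φ) z (u (proj z)) :=
    (hgs.continuous_fderiv (by simp)).clm_apply (huc.comp continuous_proj)
  have hhc : Continuous fun y : UnitAddTorus d => fderiv ℝ (Torus.lift θ ∘ Φ) (repr y) (u (proj (repr y))) := by
    rw [← Torus.continuous_lift_iff]
    have e : Torus.lift (fun y : UnitAddTorus d => fderiv ℝ (Torus.lift θ ∘ Φ) (repr y) (u (proj (repr y)))) =
        fun z => fderiv ℝ (Torus.lift θ ∘ Φ) z (u (proj z)) := by
      funext z
      rw [Torus.lift_apply]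
      exact periodic_repr_proj (g := fun z => fderiv ℝ (Torus.lift θ ∘ Φ) z (u (proj z))) hHper z
    rw [e]; exact hHc
  -- pointwise: `⟪b x, ∇θ x⟫ = H (Ψ x̃) = h (X⁻¹ x)`
  have hpt : ∀ x, ⟪b x, Torus.gradient θ x⟫_ℝ =
      (fun y : UnitAddTorus d => fderiv ℝ (Torus.lift θ ∘ Φ) (repr y) (u (proj (repr y)))) (proj (Ψ (repr x))) := by
    intro x
    rw [real_inner_comm, Torus.inner_gradient_left, hb]
    have e1 : Torus.fderiv θ x = fderiv ℝ (Torus.lift θ) (repr x) := by rw [fderiv_lift, proj_repr]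
    rw [e1]
    have e2 : fderiv ℝ (Torus.lift θ ∘ Φ) (Ψ (repr x)) = (fderiv ℝ (Torus.lift θ) (repr x)).comp (fderiv ℝ Φ (Ψ (repr x))) := by
      have hd1 : DifferentiableAt ℝ (Torus.lift θ) (Φ (Ψ (repr x))) := (hθ.differentiable (by simp)) _
      have hd2 : DifferentiableAt ℝ Φ (Ψ (repr x)) := (hΦ.differentiable (by simp)) _
      rw [fderiv_comp _ hd1 hd2, hΦΨ]
    simp only []
    rw [periodic_repr_proj (g := fun z => fderiv ℝ (Torus.lift θ ∘ Φ) z (u (proj z))) hHper, e2]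
    rfl
  -- pointwise: `h y = ⟪u y, ∇(θ ∘ X) y⟫`
  have hpt' : ∀ y : UnitAddTorus d, fderiv ℝ (Torus.lift θ ∘ Φ) (repr y) (u (proj (repr y))) =
      ⟪u y, Torus.gradient (fun y : UnitAddTorus d => θ (proj (Φ (repr y)))) y⟫_ℝ := by
    intro y
    rw [real_inner_comm, Torus.inner_gradient_left, ← hg, fderiv_lift, proj_repr]
  -- change of variables
  simp_rw [hpt]
  have hmap := integral_map (hMP.aemeasurable) (f := fun y : UnitAddTorus d => fderiv ℝ (Torus.lift θ ∘ Φ) (repr y)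
    (u (proj (repr y)))) hhc.aestronglyMeasurable
  rw [hMP.map_eq] at hmap
  rw [← hmap]
  simp_rw [hpt']
  exact hu _ hθX

end Summit.AnomalousDissipation.AnomalousDissipation.Theorems.SolenoidalFractalHomogenisation.LagrangianCarrierConstruction

end
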